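import Literature.NumberTheory.Automorphic.UnitaryGroupArchimedean
import Literature.NumberTheory.Automorphic.UnitaryGroupAdelicCenter
import Literature.NumberTheory.Automorphic.UnitaryGroupAdelicOneTorus
import Literature.NumberTheory.Automorphic.RelNormOneTorusArch
import HarnessLib

/-!
# The archimedean centre `U(1)(F ⊗ ℝ) → U(J)(E ⊗ ℝ)` and its junction with the adelic centre

For a quadratic extension `E/F` with non-trivial automorphism `c` and a form `J ∈ M_N(E)`, the scalar
`y · 1_N` of an archimedean norm-one unit `y ∈ U(1)_{E/F}(F ⊗ ℝ) ≤ (E ⊗ ℝ)ˣ` preserves every form, so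
`y ↦ y · 1_N` is a homomorphism `U(1)(F ⊗ ℝ) →* U(J)(E ⊗ ℝ)` (`archCenter`), central, and its image under
the archimedean component map `g ↦ (g, 1)` (`archToAdelic`, Borel–Jacquet §4.1) is the adelic central
element `u · 1_N` (`adelicCenter`, Mok §1) of the idele `u = (y, 1) ∈ U(1)(𝔸_F)`:

* `archCenter` — the archimedean centre map; `coe_archCenter`, `archCenter_mul_comm`;
* `archToAdelic_archCenter` — **`(y · 1_N, 1) = (y, 1) · 1_N`** in `U(J)(𝔸_F)`: the archimedean component
  of the centre is the centre of the archimedean component [Borel–Jacquet 1979, §4.1 (the decomposition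
  `G(𝔸) = G_∞ × G(𝔸_f)` is a decomposition of groups, hence of centres)];
* the CM specialisations `cmArchCenter`, `archToAdelic_cmArchCenter` (`F = L⁺`, `c` = complex conjugation).

References: A. Borel, H. Jacquet, *Automorphic forms and automorphic representations*, Proc. Sympos.
Pure Math. 33 (1979), part 1, 189–202, §4.1; C. P. Mok, *Endoscopic classification of representations of
quasi-split unitary groups*, Mem. AMS 235 (2015), §1 Notation p. 5.
-/

open NumberField NumberField.mixedEmbedding NumberField.InfinitePlace IsDedekindDomain

namespace Literature.NumberTheory.Automorphic

namespace UnitaryGroup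

section Quadratic

variable (F E : Type) [Field F] [NumberField F] [Field E] [NumberField E] [Algebra F E]
variable (c : E ≃ₐ[F] E) (N : ℕ) (J : Matrix (Fin N) (Fin N) E)

/-- the idele `(y, 1)` of an archimedean relative-norm-one unit lies in `U(1)(𝔸_F)`. [folklore] -/
theorem infiniteIdeles_mem_adelicOne (h2 : Module.finrank F E = 2) (hc : c ≠ 1)
    (y : relNormOneInfUnits F E) :
    GaloisRepresentations.infiniteIdeles E (y : (InfiniteAdeleRing E)ˣ) ∈ adelicOne F E c := by
  rw [mem_adelicOne_iff_mem_relNormOneIdeles F E c h2 hc]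
  exact (relNormOneInfToIdeles F E y).2

/-- for `y ∈ U(1)(F ⊗ ℝ)`: `(c • y) · y = 1` in `E_∞` (archimedean component of the adelic norm-one
condition). [folklore] -/
theorem conj_smul_mul_self_eq_one (h2 : Module.finrank F E = 2) (hc : c ≠ 1) (y : relNormOneInfUnits F E) :
    c • ((y : (InfiniteAdeleRing E)ˣ) : InfiniteAdeleRing E) * ((y : (InfiniteAdeleRing E)ˣ) : InfiniteAdeleRing E) = 1 := by
  have h := (mem_adelicOne_iff F E c _).mp (infiniteIdeles_mem_adelicOne F E c h2 hc y)
  have h₁ := congrArg (adeleFst E) h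
  rw [map_mul, map_one] at h₁
  have e₁ : adeleFst E (conjAdele F E c (GaloisRepresentations.infiniteIdeles E (y : (InfiniteAdeleRing E)ˣ) :
      AdeleRing (𝓞 E) E)) = c • ((y : (InfiniteAdeleRing E)ˣ) : InfiniteAdeleRing E) := rfl
  have e₂ : adeleFst E (GaloisRepresentations.infiniteIdeles E (y : (InfiniteAdeleRing E)ˣ) : AdeleRing (𝓞 E) E) =
      ((y : (InfiniteAdeleRing E)ˣ) : InfiniteAdeleRing E) := rfl
  rw [e₁, e₂] at h₁
  exact h₁

/-- for `y ∈ U(1)(F ⊗ ℝ)`: `(c ⊗ 1)(e y) · e y = 1` in `E ⊗ ℝ`, `e = ringEquiv_mixedSpace`. [folklore] -/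
theorem conjMixed_mul_self_eq_one (h2 : Module.finrank F E = 2) (hc : c ≠ 1) (y : relNormOneInfUnits F E) :
    conjMixed F E c (InfiniteAdeleRing.ringEquiv_mixedSpace E ((y : (InfiniteAdeleRing E)ˣ) : InfiniteAdeleRing E)) *
        InfiniteAdeleRing.ringEquiv_mixedSpace E ((y : (InfiniteAdeleRing E)ˣ) : InfiniteAdeleRing E) = 1 := by
  rw [conjMixed_ringEquiv, ← map_mul, conj_smul_mul_self_eq_one F E c h2 hc y, map_one]

/-- **the archimedean centre `y ↦ y · 1_N : U(1)(F ⊗ ℝ) →* U(J)(E ⊗ ℝ)`** (the scalar `y · 1_N`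
preserves every form `J`: `scalar_mem_unitaryGroupOfForm`). [cite: BorelJacquet1979, §4.1] -/
noncomputable def archCenter (h2 : Module.finrank F E = 2) (hc : c ≠ 1) : relNormOneInfUnits F E →* arch F E c N J :=
  MonoidHom.codRestrict
    ((Units.map (Matrix.scalar (Fin N) :
          mixedSpace E →+* Matrix (Fin N) (Fin N) (mixedSpace E)).toMonoidHom).comp
      ((Units.map (InfiniteAdeleRing.ringEquiv_mixedSpace E).toRingHom.toMonoidHom).comp
        (relNormOneInfUnits F E).subtype))
    (arch F E c N J) fun y =>
      scalar_mem_unitaryGroupOfForm (conjMixed F E c) (archFormOf E N J)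
        (Units.map (InfiniteAdeleRing.ringEquiv_mixedSpace E).toRingHom.toMonoidHom (y : (InfiniteAdeleRing E)ˣ))
        (conjMixed_mul_self_eq_one F E c h2 hc y)

/-- underlying matrix of the archimedean central element: the scalar matrix `e(y) · 1_N`. [folklore] -/
@[simp] theorem coe_archCenter (h2 : Module.finrank F E = 2) (hc : c ≠ 1) (y : relNormOneInfUnits F E) :
    (((archCenter F E c N J h2 hc y : arch F E c N J) : GL (Fin N) (mixedSpace E)) :
        Matrix (Fin N) (Fin N) (mixedSpace E)) =
      InfiniteAdeleRing.ringEquiv_mixedSpace E ((y : (InfiniteAdeleRing E)ˣ) : InfiniteAdeleRing E) •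
        (1 : Matrix (Fin N) (Fin N) (mixedSpace E)) :=
  (Matrix.smul_one_eq_diagonal _).symm

/-- `y · 1_N` commutes with every element of `U(J)(E ⊗ ℝ)`. [folklore] -/
theorem archCenter_mul_comm (h2 : Module.finrank F E = 2) (hc : c ≠ 1) (y : relNormOneInfUnits F E)
    (g : arch F E c N J) : archCenter F E c N J h2 hc y * g = g * archCenter F E c N J h2 hc y := by
  apply Subtype.ext
  apply Units.ext
  simp only [Subgroup.coe_mul, Units.val_mul, coe_archCenter, Matrix.mul_smul, Matrix.smul_mul, Matrix.mul_one,
    Matrix.one_mul]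

/-- **`(y · 1_N, 1) = (y, 1) · 1_N` in `U(J)(𝔸_F)`**: the archimedean component of the archimedean central
element `y · 1_N` is the adelic central element of the norm-one idele `(y, 1)`. [cite: BorelJacquet1979, §4.1] -/
theorem archToAdelic_archCenter (h2 : Module.finrank F E = 2) (hc : c ≠ 1) (y : relNormOneInfUnits F E) :
    archToAdelic F E c N J (archCenter F E c N J h2 hc y) =
      adelicCenter F E c N J ((adelicOneEquivRelNormOne F E c h2 hc).symm (relNormOneInfToIdeles F E y)) := by
  apply Subtype.ext
  apply Units.ext
  show ((GLn.ofInfinite N E (archCenter F E c N J h2 hc y : arch F E c N J) : GL (Fin N) (AdeleRing (𝓞 E) E)) :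
      Matrix (Fin N) (Fin N) (AdeleRing (𝓞 E) E)) = _
  rw [coe_adelicCenter]
  have hu : ((((adelicOneEquivRelNormOne F E c h2 hc).symm (relNormOneInfToIdeles F E y) : adelicOne F E c) :
      (AdeleRing (𝓞 E) E)ˣ) : AdeleRing (𝓞 E) E) =
        (((y : (InfiniteAdeleRing E)ˣ) : InfiniteAdeleRing E), (1 : FiniteAdeleRing (𝓞 E) E)) := rfl
  rw [hu]
  ext i j
  rw [GLn.coe_ofInfinite_apply, coe_archCenter, Matrix.smul_apply, Matrix.smul_apply, smul_eq_mul, smul_eq_mul,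
    map_mul, RingEquiv.symm_apply_apply]
  by_cases hij : i = j
  · subst hij
    simp only [Matrix.one_apply_eq, map_one, mul_one]
    try rfl
  · simp only [Matrix.one_apply_ne hij, map_zero, mul_zero]
    try rfl

end Quadratic

section CM

variable (L : Type) [Field L] [NumberField L] [IsCMField L] (N : ℕ) (H : Matrix (Fin N) (Fin N) L)

/-- **the CM archimedean centre** `U(1)(L⁺ ⊗ ℝ) →* U(H)(L ⊗ ℝ)`, `y ↦ y · 1_N`. [cite: BorelJacquet1979, §4.1] -/
noncomputable def cmArchCenter :
    relNormOneInfUnits (↥(maximalRealSubfield L)) L →*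
      arch (↥(maximalRealSubfield L)) L (IsCMField.complexConj L) N H :=
  archCenter _ L _ N H (Algebra.IsQuadraticExtension.finrank_eq_two _ L) (IsCMField.complexConj_ne_one (K := L))

/-- `cmArchCenter` is `archCenter` (definitional). [folklore] -/
theorem cmArchCenter_eq : cmArchCenter L N H =
    archCenter _ L _ N H (Algebra.IsQuadraticExtension.finrank_eq_two _ L) (IsCMField.complexConj_ne_one (K := L)) :=
  rfl

/-- **CM junction `(y · 1_N, 1) = (y, 1) · 1_N`** with the tree's `cmAdelicOneEquivRelNormOne`. [cite: BorelJacquet1979, §4.1] -/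
theorem archToAdelic_cmArchCenter (y : relNormOneInfUnits (↥(maximalRealSubfield L)) L) :
    archToAdelic _ L (IsCMField.complexConj L) N H (cmArchCenter L N H y) =
      adelicCenter _ L (IsCMField.complexConj L) N H
        ((cmAdelicOneEquivRelNormOne L).symm (relNormOneInfToIdeles _ L y)) :=
  archToAdelic_archCenter _ L _ N H _ _ y

end CM

end UnitaryGroup

end Literature.NumberTheory.Automorphic
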